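import Summits.NavierStokesRegularity.NavierStokesRegularity.Theorems.CoriolisHeadTypeIRateTransport
import Literature.Analysis.FluidPDE.TsaiTopSingularNullHolds
import Mathlib.MeasureTheory.Measure.Hausdorff
import HarnessLib

/-!
# CoriolisHeadLocalEnergyDecayOfTopNull — crux `NoCoRotatingCore` (stmt-NavierStokesRegularity-22676), line
# `local_energy_rescue` v2.1 (crux workfile `Cruxes/NoCoRotatingCore/Lines/local_energy_rescue.lean`, ns-idea-10 g3;
# NOT the registered skeleton): **stub S3b `stub_decayOfTopNull` proved, statement verbatim** (seat ns-ffc-k1 g2, helper)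

S3b: if the PHYSICAL rotated self-similar field `u(t,x) = λ e^{θB} U(λ e^{−θB} x)` (`λ = (2a(0−t))^{−1/2}`,
`θ = a⁻¹ log λ`, blow-up time `0`) of a bounded smooth profile `U` lies in the Caffarelli–Kohn–Nirenberg / Tsai class
on the top cylinder `Q₁(0,0)` (suitable weak solution, `L^∞_t L²_x`, `∇u ∈ L²`, `p ∈ L^{3/2}`), then the profile DECAYS AT
THE TYPE-I RATE `‖U(y)‖ ≤ K'/(1 + ‖y‖)`.

PROOF (Tsai 1998, Cor. 4.3, ROTATING version; no spiral geometry).  The tree-PROVED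
`tsai1998_top_singular_null_holds` gives `μH[1] {x ∈ B₁ : (0,x) backward-singular} = 0`.  If `sup ‖y‖‖U(y)‖ = ∞`,
pick `y_k` with `‖y_k‖‖U(y_k)‖ > k`; for a radius `σ ∈ (0,1)` the time `t_k = −σ²/(2a‖y_k‖²) ↑ 0` has `λ(t_k) = ‖y_k‖/σ`,
and `x_k = λ_k⁻¹ e^{θ_k B} y_k` has `‖x_k‖ = σ` (`e^{θB}` is an isometry for skew `B`) and `‖u(t_k,x_k)‖ = λ_k‖U(y_k)‖ > k/σ`
(§1).  A cluster point `x*(σ)` on the sphere is backward-singular: `u` is continuous below `t = 0` (§2), so it exceeds every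
level on an open subset of every `Q_r(0,x*)` (§3).  The 1-Lipschitz radial map `x ↦ ‖x‖` sends the null top-singular set onto
a set containing `(0,1)`, of `μH[1]`-measure `1` (`LipschitzWith.hausdorffMeasure_image_le`, `hausdorffMeasure_real`) —
contradiction; hence `sup ‖y‖‖U(y)‖ < ∞` and `‖U(y)‖ ≤ (M + sup)/(1 + ‖y‖)`.

HONEST FRAMING.  A helper for an UNREGISTERED line (no stub credit claimed): the CKN-class hypothesis is the open part
(stubs S1 drift normal form, S2 density bootstrap, S3a local energy class of that line); together they would give far-field
constancy at the Type-I rate (K1 of line `far_field_constancy`) WITHOUT K1a.  Nothing here proves `NoCoRotatingCore`,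
Pineau–Vicol's Conjecture 1.1 or Navier–Stokes regularity.

References: T.-P. Tsai, ARMA 143 (1998) 29–51, Lemma 4.2, Cor. 4.3 (p. 46–47) [Tsai1998]; L. Caffarelli, R. Kohn,
L. Nirenberg, CPAM 35 (1982), Prop. 2 / Thm B [CaffarelliKohnNirenberg1982]; line card `Lines/local_energy_rescue.md`.
-/

noncomputable section

open MeasureTheory Set Function Filter Topology Metric InnerProductSpace Real
open scoped RealInnerProductSpace Laplacian ContDiff ENNReal NNReal Topology

-- the summit and its single sub-problem share the name (CONVENTIONS §1), as in every Theorems file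
set_option linter.dupNamespace false

namespace Summit.NavierStokesRegularity.NavierStokesRegularity.Theorems.CoriolisHead

namespace LocalEnergyRescue

open Literature.Analysis.FluidPDE

variable {a : ℝ} {B : EuclideanSpace ℝ (Fin 3) →L[ℝ] EuclideanSpace ℝ (Fin 3)}
  {U : EuclideanSpace ℝ (Fin 3) → EuclideanSpace ℝ (Fin 3)}
  {u : ℝ → EuclideanSpace ℝ (Fin 3) → EuclideanSpace ℝ (Fin 3)}

/-! ## §1 The rotated self-similar ansatz on the spiral through a far point -/

/-- **The ansatz read at the right time.**  For `y ≠ 0` and `σ > 0`, at the time `t = −σ²/(2a‖y‖²)` one has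
`λ(t) = (√(2a(0−t)))⁻¹ = ‖y‖/σ`, and the point `x = λ⁻¹ e^{θB} y` (`θ = a⁻¹ log λ`) satisfies `‖x‖ = σ`, `t < 0` and
`‖u(t,x)‖ = ‖y‖‖U(y)‖/σ`. [cite: Tsai1998, Cor. 4.3 (p. 47)] -/
theorem exists_point_norm_eq (ha : 0 < a) (hB : ∀ x, inner ℝ (B x) x = 0)
    (hu : ∀ (t : ℝ) (x : EuclideanSpace ℝ (Fin 3)), u t x =
      (Real.sqrt (2 * a * (0 - t)))⁻¹ • (NormedSpace.exp ((a⁻¹ * Real.log (Real.sqrt (2 * a * (0 - t)))⁻¹) • B))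
        (U ((Real.sqrt (2 * a * (0 - t)))⁻¹ •
          (NormedSpace.exp ((-(a⁻¹ * Real.log (Real.sqrt (2 * a * (0 - t)))⁻¹)) • B)) x)))
    {y : EuclideanSpace ℝ (Fin 3)} (hy : y ≠ 0) {σ : ℝ} (hσ : 0 < σ) :
    ∃ x : EuclideanSpace ℝ (Fin 3), ‖x‖ = σ ∧
      ‖u (-(σ ^ 2 / (2 * a * ‖y‖ ^ 2))) x‖ = ‖y‖ * ‖U y‖ / σ := by
  have hypos : 0 < ‖y‖ := norm_pos_iff.2 hy
  set t : ℝ := -(σ ^ 2 / (2 * a * ‖y‖ ^ 2)) with ht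
  have hsq : Real.sqrt (2 * a * (0 - t)) = σ / ‖y‖ := by
    have e : 2 * a * (0 - t) = (σ / ‖y‖) ^ 2 := by
      rw [ht]; field_simp; ring
    rw [e, Real.sqrt_sq (by positivity)]
  set Λ : ℝ := (Real.sqrt (2 * a * (0 - t)))⁻¹ with hΛ
  have hΛeq : Λ = ‖y‖ / σ := by rw [hΛ, hsq, inv_div]
  have hΛpos : 0 < Λ := by rw [hΛeq]; positivity
  set θ : ℝ := a⁻¹ * Real.log Λ with hθ
  refine ⟨Λ⁻¹ • NormedSpace.exp (θ • B) y, ?_, ?_⟩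
  · rw [norm_smul, Real.norm_of_nonneg (inv_nonneg.2 hΛpos.le), TypeIRate.norm_exp_smul_skew hB, hΛeq,
      inv_div]
    field_simp
  · have hinner : Λ • (NormedSpace.exp ((-θ) • B)) (Λ⁻¹ • NormedSpace.exp (θ • B) y) = y := by
      rw [map_smul, smul_smul, mul_inv_cancel₀ hΛpos.ne', one_smul]
      have h := TypeIRate.flow_flow_neg B y (-θ)
      rwa [neg_neg] at h
    rw [hu t, ← hΛ, ← hθ, hinner, norm_smul, Real.norm_of_nonneg hΛpos.le,
      TypeIRate.norm_exp_smul_skew hB, hΛeq]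
    ring

/-! ## §2 Continuity of the physical field below the blow-up time -/

/-- The physical field of a smooth profile is continuous at every space–time point with `t < 0`. [folklore] -/
theorem continuousAt_uncurry (ha : 0 < a) (hUc : Continuous U)
    (hu : ∀ (t : ℝ) (x : EuclideanSpace ℝ (Fin 3)), u t x =
      (Real.sqrt (2 * a * (0 - t)))⁻¹ • (NormedSpace.exp ((a⁻¹ * Real.log (Real.sqrt (2 * a * (0 - t)))⁻¹) • B))
        (U ((Real.sqrt (2 * a * (0 - t)))⁻¹ •
          (NormedSpace.exp ((-(a⁻¹ * Real.log (Real.sqrt (2 * a * (0 - t)))⁻¹)) • B)) x)))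
    {w : ℝ × EuclideanSpace ℝ (Fin 3)} (hw : w.1 < 0) : ContinuousAt (uncurry u) w := by
  have hfun : uncurry u = fun w : ℝ × EuclideanSpace ℝ (Fin 3) =>
      (Real.sqrt (2 * a * (0 - w.1)))⁻¹ •
        (NormedSpace.exp ((a⁻¹ * Real.log (Real.sqrt (2 * a * (0 - w.1)))⁻¹) • B))
          (U ((Real.sqrt (2 * a * (0 - w.1)))⁻¹ •
            (NormedSpace.exp ((-(a⁻¹ * Real.log (Real.sqrt (2 * a * (0 - w.1)))⁻¹)) • B)) w.2)) := by
    funext w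
    exact hu w.1 w.2
  rw [hfun]
  -- the scalar factor `Λ(t) = (√(2a(0−t)))⁻¹` and the angle `θ(t)` are continuous at `w`
  have hpos : 0 < Real.sqrt (2 * a * (0 - w.1)) := Real.sqrt_pos.2 (by nlinarith)
  have hS : ContinuousAt (fun w : ℝ × EuclideanSpace ℝ (Fin 3) => Real.sqrt (2 * a * (0 - w.1))) w :=
    (Real.continuous_sqrt.comp (by fun_prop : Continuous fun w : ℝ × EuclideanSpace ℝ (Fin 3) =>
      2 * a * (0 - w.1))).continuousAt
  have hΛ : ContinuousAt (fun w : ℝ × EuclideanSpace ℝ (Fin 3) => (Real.sqrt (2 * a * (0 - w.1)))⁻¹) w :=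
    hS.inv₀ hpos.ne'
  have hθ : ContinuousAt
      (fun w : ℝ × EuclideanSpace ℝ (Fin 3) => a⁻¹ * Real.log (Real.sqrt (2 * a * (0 - w.1)))⁻¹) w :=
    continuousAt_const.mul (hΛ.log (inv_ne_zero hpos.ne'))
  -- `s ↦ exp(sB)` is differentiable, hence continuous
  have hexpc : Continuous fun s : ℝ => NormedSpace.exp (s • B) :=
    continuous_iff_continuousAt.2 fun s => (hasDerivAt_exp_smul_const' (𝕂 := ℝ) B s).continuousAt
  have hE : ContinuousAt (fun w : ℝ × EuclideanSpace ℝ (Fin 3) =>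
      NormedSpace.exp ((a⁻¹ * Real.log (Real.sqrt (2 * a * (0 - w.1)))⁻¹) • B)) w :=
    hexpc.continuousAt.comp hθ
  have hE' : ContinuousAt (fun w : ℝ × EuclideanSpace ℝ (Fin 3) =>
      NormedSpace.exp ((-(a⁻¹ * Real.log (Real.sqrt (2 * a * (0 - w.1)))⁻¹)) • B)) w :=
    hexpc.continuousAt.comp hθ.neg
  have hin : ContinuousAt (fun w : ℝ × EuclideanSpace ℝ (Fin 3) =>
      (Real.sqrt (2 * a * (0 - w.1)))⁻¹ •
        (NormedSpace.exp ((-(a⁻¹ * Real.log (Real.sqrt (2 * a * (0 - w.1)))⁻¹)) • B)) w.2) w :=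
    hΛ.smul (hE'.clm_apply continuousAt_snd)
  have hUin := hUc.continuousAt.comp hin
  exact hΛ.smul (hE.clm_apply hUin)

/-! ## §3 Essential unboundedness from a blowing-up sequence of continuity points -/

/-- If on an open set `Q` a function exceeds every level at some point of continuity, its `L^∞(Q)` norm is infinite.
[folklore] -/
theorem eLpNorm_top_eq_top_of_unbounded {f : ℝ × EuclideanSpace ℝ (Fin 3) → EuclideanSpace ℝ (Fin 3)}
    {Q : Set (ℝ × EuclideanSpace ℝ (Fin 3))} (hQ : IsOpen Q)
    (h : ∀ N : ℝ, ∃ w ∈ Q, ContinuousAt f w ∧ N < ‖f w‖) :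
    eLpNorm f (⊤ : ℝ≥0∞) (volume.restrict Q) = ⊤ := by
  by_contra hne
  set E : ℝ≥0∞ := eLpNorm f (⊤ : ℝ≥0∞) (volume.restrict Q) with hE
  have hEN : E = ENNReal.ofReal E.toReal := (ENNReal.ofReal_toReal hne).symm
  obtain ⟨w, hwQ, hcont, hNw⟩ := h E.toReal
  -- an open neighbourhood of `w` inside `Q` on which `‖f‖ > E.toReal`
  have hopen : IsOpen {v : EuclideanSpace ℝ (Fin 3) | E.toReal < ‖v‖} := isOpen_lt continuous_const continuous_norm
  have hpre : f ⁻¹' {v | E.toReal < ‖v‖} ∈ 𝓝 w := hcont.preimage_mem_nhds (hopen.mem_nhds hNw)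
  have hmem : f ⁻¹' {v | E.toReal < ‖v‖} ∩ Q ∈ 𝓝 w := inter_mem hpre (hQ.mem_nhds hwQ)
  obtain ⟨O, hOsub, hOopen, hwO⟩ := _root_.mem_nhds_iff.1 hmem
  have hOpos : 0 < volume O := hOopen.measure_pos volume ⟨w, hwO⟩
  have hOQ : O ⊆ Q := fun v hv => (hOsub hv).2
  -- but a.e. on `Q`, `‖f‖ₑ ≤ E`
  have hae : ∀ᵐ v ∂(volume.restrict Q), ‖f v‖ₑ ≤ E := by
    have h1 := ae_le_eLpNormEssSup (f := f) (μ := volume.restrict Q)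
    rw [← eLpNorm_exponent_top] at h1
    exact h1
  have hzero : (volume.restrict Q) {v | ¬ ‖f v‖ₑ ≤ E} = 0 := ae_iff.1 hae
  have hOle : (volume.restrict Q) O ≤ (volume.restrict Q) {v | ¬ ‖f v‖ₑ ≤ E} := by
    refine measure_mono fun v hv => ?_
    have hlt : E.toReal < ‖f v‖ := (hOsub hv).1
    simp only [mem_setOf_eq, not_le]
    rw [hEN, ← ofReal_norm]
    exact (ENNReal.ofReal_lt_ofReal_iff ((ENNReal.toReal_nonneg).trans_lt hlt)).2 hlt
  have hOres : (volume.restrict Q) O = volume O := by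
    rw [Measure.restrict_apply hOopen.measurableSet, inter_eq_left.2 hOQ]
  rw [hzero, hOres] at hOle
  exact absurd hOle (not_le.2 hOpos)

/-! ## §4 Stub S3b by name -/

end LocalEnergyRescue

open LocalEnergyRescue Literature.Analysis.FluidPDE in
/-- **stub S3b — `stub_decayOfTopNull`** of the line `local_energy_rescue` v2.1 (crux `CoriolisHead.NoCoRotatingCore`,
item 22676; statement verbatim from the crux workfile `Lines/local_energy_rescue.lean`, with the skeleton's local notation
`E3` spelled out as `EuclideanSpace ℝ (Fin 3)`): if the physical rotated
self-similar field of a bounded smooth profile lies in the CKN/Tsai class on `Q₁(0,0)`, the profile decays at the Type-I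
rate `‖U(y)‖ ≤ K'/(1 + ‖y‖)`.  Rotating Tsai Cor. 4.3: `tsai1998_top_singular_null_holds` + one backward-singular point on
every sphere `‖x‖ = σ ∈ (0,1)` if `sup ‖y‖‖U(y)‖ = ∞` + the 1-Lipschitz radial map; see the module docstring.  The
profile equation, `ν`, `P` and div-freeness are not used.  Nothing here proves `NoCoRotatingCore` or NS regularity.
[cite: Tsai1998, Lemma 4.2 and Cor. 4.3 (pp. 46–47)] -/
theorem stub_decayOfTopNull :
    ∀ (ν a : ℝ), 0 < ν → 0 < a → ∀ (B : EuclideanSpace ℝ (Fin 3) →L[ℝ] EuclideanSpace ℝ (Fin 3)) (U : EuclideanSpace ℝ (Fin 3) → EuclideanSpace ℝ (Fin 3)) (P : EuclideanSpace ℝ (Fin 3) → ℝ),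
      ContDiff ℝ (⊤ : ℕ∞) U → ContDiff ℝ 2 P → (∀ x, inner ℝ (B x) x = 0) →
      Literature.Analysis.FluidPDE.VectorCalculus.IsDivFree U →
      (∀ y, -(ν • Laplacian.laplacian U y) + a • U y + a • fderiv ℝ U y y
        + (B (U y) - fderiv ℝ U y (B y)) + Literature.Analysis.FluidPDE.convect U U y
        + gradient P y = 0) →
      (∃ M : ℝ, ∀ y, ‖U y‖ ≤ M) →
      ∀ (u : ℝ → EuclideanSpace ℝ (Fin 3) → EuclideanSpace ℝ (Fin 3)), (∀ (t : ℝ) (x : EuclideanSpace ℝ (Fin 3)), u t x = (Real.sqrt (2 * a * (0 - t)))⁻¹ • (NormedSpace.exp ((a⁻¹ * Real.log (Real.sqrt (2 * a * (0 - t)))⁻¹) • B)) (U ((Real.sqrt (2 * a * (0 - t)))⁻¹ • (NormedSpace.exp ((-(a⁻¹ * Real.log (Real.sqrt (2 * a * (0 - t)))⁻¹)) • B)) x))) →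
      (∃ p : ℝ → EuclideanSpace ℝ (Fin 3) → ℝ,
        IsSuitableWeakSolutionOn (parabolicCylinderOpens 1 ((0 : ℝ), (0 : EuclideanSpace ℝ (Fin 3)))) ν 0 u p ∧
        (∃ C : ℝ≥0, ∀ᵐ t : ℝ, t ∈ Set.Ioo ((0 : ℝ) - 1 ^ 2) 0 →
          ∫⁻ x in Metric.ball (0 : EuclideanSpace ℝ (Fin 3)) 1, ‖u t x‖ₑ ^ 2 ≤ C) ∧
        (∃ G : ℝ → EuclideanSpace ℝ (Fin 3) → EuclideanSpace ℝ (Fin 3) →L[ℝ] EuclideanSpace ℝ (Fin 3), HasWeakSpatialGradientOn (parabolicCylinderOpens 1 ((0 : ℝ), (0 : EuclideanSpace ℝ (Fin 3)))) u G ∧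
          ∫⁻ z in parabolicCylinder 1 ((0 : ℝ), (0 : EuclideanSpace ℝ (Fin 3))), ENNReal.ofReal (frobeniusNormSq (G z.1 z.2)) < ⊤) ∧
        (∫⁻ z in parabolicCylinder 1 ((0 : ℝ), (0 : EuclideanSpace ℝ (Fin 3))), ‖p z.1 z.2‖ₑ ^ (3 / 2 : ℝ) < ⊤)) →
      ∃ K' : ℝ, ∀ y, ‖U y‖ ≤ K' / (1 + ‖y‖) := by
  intro ν a hν ha B U P hU hP hB hdiv heq hbdd u hu hclass
  obtain ⟨M, hM⟩ := hbdd
  have hM0 : 0 ≤ M := (norm_nonneg _).trans (hM 0)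
  obtain ⟨p, hsuit, henergy, hgrad, hp⟩ := hclass
  -- Tsai's top-singular-set nullity on `Q₁(0,0)`
  have hnull : μH[1] {x ∈ ball (0 : EuclideanSpace ℝ (Fin 3)) 1 | IsBackwardSingularPoint u (0, x)} = 0 :=
    tsai1998_top_singular_null_holds hν one_pos hsuit henergy hgrad hp
  -- suppose the Type-I rate fails: `‖y‖‖U y‖` is unbounded
  by_contra hK
  have hunb : ∀ k : ℕ, ∃ y : EuclideanSpace ℝ (Fin 3), (k : ℝ) < ‖y‖ * ‖U y‖ := by
    intro k
    by_contra hk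
    push Not at hk
    refine hK ⟨k + M, fun y => ?_⟩
    have h1 : 0 < 1 + ‖y‖ := by positivity
    rw [le_div_iff₀ h1]
    nlinarith [hk y, hM y, norm_nonneg y, norm_nonneg (U y)]
  choose y hy using hunb
  have hy0 : ∀ k, y k ≠ 0 := fun k h => by
    have := hy k
    rw [h, norm_zero, zero_mul] at this
    exact absurd this (not_lt.2 (Nat.cast_nonneg _))
  have hybig : ∀ k : ℕ, (k : ℝ) < (M + 1) * ‖y k‖ := fun k => by
    have h1 : ‖y k‖ * ‖U (y k)‖ ≤ ‖y k‖ * M := mul_le_mul_of_nonneg_left (hM _) (norm_nonneg _)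
    nlinarith [hy k, norm_nonneg (y k)]
  have hUc : Continuous U := hU.continuous
  -- every sphere `‖x‖ = σ`, `σ ∈ (0,1)`, carries a backward-singular point of `u` at the top time `0`
  have hsphere : ∀ σ ∈ Ioo (0 : ℝ) 1, ∃ x : EuclideanSpace ℝ (Fin 3), ‖x‖ = σ ∧ IsBackwardSingularPoint u (0, x) := by
    intro σ hσ
    -- the points `x k` on the sphere and the times `t k ↑ 0`
    have hpt : ∀ k, ∃ x : EuclideanSpace ℝ (Fin 3), ‖x‖ = σ ∧
        ‖u (-(σ ^ 2 / (2 * a * ‖y k‖ ^ 2))) x‖ = ‖y k‖ * ‖U (y k)‖ / σ :=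
      fun k => exists_point_norm_eq ha hB hu (hy0 k) hσ.1
    choose x hxσ hxu using hpt
    set t : ℕ → ℝ := fun k => -(σ ^ 2 / (2 * a * ‖y k‖ ^ 2)) with htdef
    have hxs : ∀ k, x k ∈ Metric.sphere (0 : EuclideanSpace ℝ (Fin 3)) σ := fun k => by
      rw [mem_sphere_zero_iff_norm]; exact hxσ k
    obtain ⟨xs, hxs_mem, φ, hφ, hφlim⟩ := (isCompact_sphere (0 : EuclideanSpace ℝ (Fin 3)) σ).tendsto_subseq hxs
    refine ⟨xs, mem_sphere_zero_iff_norm.1 hxs_mem, fun r hr => ?_⟩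
    refine eLpNorm_top_eq_top_of_unbounded (isOpen_parabolicCylinder r ((0 : ℝ), xs)) fun N => ?_
    -- choose an index along the subsequence with all three requirements
    have ev1 : ∀ᶠ n in atTop, dist (x (φ n)) xs < r := by
      have := hφlim
      rw [Metric.tendsto_atTop] at this
      obtain ⟨n₀, hn₀⟩ := this r hr
      exact eventually_atTop.2 ⟨n₀, hn₀⟩
    have ev2 : ∀ᶠ n in atTop, max N 0 + 1 < (φ n : ℝ) ∧ σ ^ 2 / (2 * a * r ^ 2) * (M + 1) ^ 2 < (φ n : ℝ) ^ 2 := by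
      have hφge : ∀ n : ℕ, (n : ℝ) ≤ (φ n : ℝ) := fun n => by exact_mod_cast hφ.id_le n
      obtain ⟨n₁, hn₁⟩ := exists_nat_gt (max N 0 + 1 + Real.sqrt (σ ^ 2 / (2 * a * r ^ 2) * (M + 1) ^ 2))
      refine eventually_atTop.2 ⟨n₁, fun n hn => ?_⟩
      have hnn : (n₁ : ℝ) ≤ (φ n : ℝ) := (show (n₁ : ℝ) ≤ n by exact_mod_cast hn).trans (hφge n)
      have hsq0 : 0 ≤ Real.sqrt (σ ^ 2 / (2 * a * r ^ 2) * (M + 1) ^ 2) := Real.sqrt_nonneg _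
      constructor
      · linarith
      · have hlt : Real.sqrt (σ ^ 2 / (2 * a * r ^ 2) * (M + 1) ^ 2) < (φ n : ℝ) := by
          linarith [le_max_right N 0]
        have h0 : 0 ≤ σ ^ 2 / (2 * a * r ^ 2) * (M + 1) ^ 2 := by positivity
        nlinarith [Real.sq_sqrt h0, hsq0]
    obtain ⟨n, hn1, hn2, hn3⟩ := (ev1.and ev2).exists
    set k := φ n with hk
    -- the time `t k` lies in `(−r², 0)`
    have hyk : 0 < ‖y k‖ := norm_pos_iff.2 (hy0 k)
    have hσpos : 0 < σ := hσ.1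
    have htneg : t k < 0 := by
      simp only [htdef]
      exact neg_neg_of_pos (by positivity)
    have htgt : 0 - r ^ 2 < t k := by
      simp only [htdef]
      -- `σ²/(2a‖y_k‖²) < r²` since `(M+1)‖y_k‖ > k` and `k² > σ²(M+1)²/(2a r²)`
      have h1 : (k : ℝ) ^ 2 < ((M + 1) * ‖y k‖) ^ 2 := by
        have := hybig k
        have hk0 : (0 : ℝ) ≤ k := by positivity
        nlinarith
      have h2 : σ ^ 2 / (2 * a * r ^ 2) * (M + 1) ^ 2 < ((M + 1) * ‖y k‖) ^ 2 := hn3.trans h1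
      have hM1 : 0 < (M + 1) ^ 2 := by positivity
      have h3 : σ ^ 2 / (2 * a * r ^ 2) < ‖y k‖ ^ 2 := by
        rw [mul_pow] at h2
        nlinarith
      have h4 : σ ^ 2 / (2 * a * ‖y k‖ ^ 2) < r ^ 2 := by
        rw [div_lt_iff₀ (by positivity)] at h3 ⊢
        calc σ ^ 2 < ‖y k‖ ^ 2 * (2 * a * r ^ 2) := h3
          _ = r ^ 2 * (2 * a * ‖y k‖ ^ 2) := by ring
      linarith
    refine ⟨(t k, x k), ?_, ?_, ?_⟩
    · rw [mem_parabolicCylinder]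
      exact ⟨⟨htgt, htneg⟩, hn1⟩
    · exact continuousAt_uncurry ha hUc hu htneg
    · -- `‖u(t_k, x_k)‖ = ‖y_k‖‖U(y_k)‖/σ > k ≥ N`
      show N < ‖u (t k) (x k)‖
      rw [hxu k, lt_div_iff₀ hσ.1]
      have : N * σ ≤ max N 0 := by
        rcases le_or_gt 0 N with hN | hN
        · calc N * σ ≤ N * 1 := by gcongr; exact hσ.2.le
            _ = max N 0 := by rw [mul_one, max_eq_left hN]
        · exact (mul_neg_of_neg_of_pos hN hσ.1).le.trans (le_max_right _ _)
      linarith [hy k]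
  -- the radial images of the top singular set cover `(0,1)`: contradiction with `μH[1] = 0`
  set Sing : Set (EuclideanSpace ℝ (Fin 3)) := {x ∈ ball (0 : EuclideanSpace ℝ (Fin 3)) 1 | IsBackwardSingularPoint u (0, x)} with hSing
  have hcover : Ioo (0 : ℝ) 1 ⊆ (fun x : EuclideanSpace ℝ (Fin 3) => ‖x‖) '' Sing := by
    intro σ hσ
    obtain ⟨x, hxσ, hxs⟩ := hsphere σ hσ
    refine ⟨x, ⟨?_, hxs⟩, hxσ⟩
    rw [mem_ball_zero_iff, hxσ]; exact hσ.2
  have himg : μH[1] ((fun x : EuclideanSpace ℝ (Fin 3) => ‖x‖) '' Sing) ≤ μH[1] Sing := by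
    have h := (lipschitzWith_one_norm (E := EuclideanSpace ℝ (Fin 3))).hausdorffMeasure_image_le zero_le_one Sing
    simpa using h
  have hIoo : μH[1] (Ioo (0 : ℝ) 1) = 1 := by
    rw [hausdorffMeasure_real, Real.volume_Ioo]; norm_num
  have hle : μH[1] (Ioo (0 : ℝ) 1) ≤ 0 :=
    calc μH[1] (Ioo (0 : ℝ) 1) ≤ μH[1] ((fun x : EuclideanSpace ℝ (Fin 3) => ‖x‖) '' Sing) := measure_mono hcover
      _ ≤ μH[1] Sing := himg
      _ = 0 := hnull
  rw [hIoo] at hle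
  exact absurd hle (by norm_num)

end Summit.NavierStokesRegularity.NavierStokesRegularity.Theorems.CoriolisHead

end
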